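import Summits.AtomisticToContinuum.Crystallization.Theorems.ChessboardParticlePlanesPeriodicWindowsShapeStationarity2

/-!
# Crux `PeriodicWindows` (stmt-AtomisticToContinuum-3240), line `Sketch` — stub E2a, part 3: the Lennard-Jones site energy in shape sums

Helper file for the registered stub `stub_shapeStationarity` (E2a) of the lead skeleton `PeriodicWindowsSketch`
(rev 9). With `Vₙ r = (r²)⁻ⁿ` (so `V_LJ = V₆/12 − V₃/6`):

* `shp_barlowSiteEnergy_linear` — `barlowSiteEnergy` is linear in the pair function (under summability of the index
  families);
* `shp_barlowSiteEnergy_smul` — scaling `barlowSiteEnergy Vₙ a (a c) s m = (a²)⁻ⁿ · barlowSiteEnergy Vₙ 1 c s m`;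
* `shp_site_lennardJones` — **the Lennard-Jones site energy of a point of layer `m` of `A '' barlowStacking a (a c) s`
  is `2 ((a²)⁻⁶ σ₆(m)/12 − (a²)⁻³ σ₃(m)/6)`** with the SITE SHAPE SUMS `σₙ(m) = barlowSiteEnergy Vₙ 1 c s m`.

All `[folklore]`.
-/

noncomputable section

namespace Summit.AtomisticToContinuum.Crystallization.Theorems.PeriodicWindowsSketch

open Literature.MathematicalPhysics.StatisticalMechanics

/-! ## Linearity of `barlowSiteEnergy` in the pair function -/

/-- A punctured fibre of a summable index family is summable. [folklore] -/
theorem shp_summable_punctured {f : ℤ × ℤ → ℝ} (hf : Summable f) :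
    Summable fun ij : ℤ × ℤ => if ij = 0 then 0 else f ij := by
  have h1 : Summable fun ij : ℤ × ℤ => if ij = 0 then f 0 else 0 :=
    summable_of_ne_finset_zero (s := {0}) fun ij hij => by
      rw [Finset.mem_singleton] at hij; rw [if_neg hij]
  refine (hf.sub h1).congr fun ij => ?_
  by_cases hij : ij = 0
  · subst hij; simp
  · simp [hij]

/-- **Linearity of `barlowSiteEnergy` in `V`** (for index families summable from the base point of layer `m`).
[folklore] -/
theorem shp_barlowSiteEnergy_linear {a h : ℝ} (s : ℤ → ℤ) (m : ℤ) (V₁ V₂ : ℝ → ℝ) (c₁ c₂ : ℝ)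
    (hG₁ : Summable fun t : ℤ × ℤ × ℤ => V₁ (dist (barlowPos a h s m 0 0) (barlowPos a h s t.1 t.2.1 t.2.2)))
    (hG₂ : Summable fun t : ℤ × ℤ × ℤ => V₂ (dist (barlowPos a h s m 0 0) (barlowPos a h s t.1 t.2.1 t.2.2))) :
    barlowSiteEnergy (fun r => c₁ * V₁ r - c₂ * V₂ r) a h s m =
      c₁ * barlowSiteEnergy V₁ a h s m - c₂ * barlowSiteEnergy V₂ a h s m := by
  -- fibres and outer sums
  have hF₁ : ∀ k : ℤ, Summable fun ij : ℤ × ℤ => V₁ (dist (barlowPos a h s m 0 0) (barlowPos a h s k ij.1 ij.2)) :=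
    fun k => hG₁.prod_factor k
  have hF₂ : ∀ k : ℤ, Summable fun ij : ℤ × ℤ => V₂ (dist (barlowPos a h s m 0 0) (barlowPos a h s k ij.1 ij.2)) :=
    fun k => hG₂.prod_factor k
  have hO₁ : Summable fun k : ℤ => ∑' ij : ℤ × ℤ, V₁ (dist (barlowPos a h s m 0 0) (barlowPos a h s k ij.1 ij.2)) :=
    hG₁.prod
  have hO₂ : Summable fun k : ℤ => ∑' ij : ℤ × ℤ, V₂ (dist (barlowPos a h s m 0 0) (barlowPos a h s k ij.1 ij.2)) :=
    hG₂.prod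
  have hinjp : Function.Injective fun n : ℕ => m + ((n + 1 : ℕ) : ℤ) := fun x y hxy => by
    have : ((x + 1 : ℕ) : ℤ) = ((y + 1 : ℕ) : ℤ) := add_left_cancel hxy
    omega
  have hinjm : Function.Injective fun n : ℕ => m - ((n + 1 : ℕ) : ℤ) := fun x y hxy => by
    have : ((x + 1 : ℕ) : ℤ) = ((y + 1 : ℕ) : ℤ) := sub_right_injective hxy
    omega
  have hA₁ := hO₁.comp_injective hinjp
  have hA₂ := hO₂.comp_injective hinjp
  have hB₁ := hO₁.comp_injective hinjm
  have hB₂ := hO₂.comp_injective hinjm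
  simp only [Function.comp_def] at hA₁ hA₂ hB₁ hB₂
  -- the three pieces
  have hX : ∑' ij : ℤ × ℤ, (if ij = 0 then 0 else
        (c₁ * V₁ (dist (barlowPos a h s m 0 0) (barlowPos a h s m ij.1 ij.2)) -
          c₂ * V₂ (dist (barlowPos a h s m 0 0) (barlowPos a h s m ij.1 ij.2)))) =
      c₁ * ∑' ij : ℤ × ℤ, (if ij = 0 then 0 else V₁ (dist (barlowPos a h s m 0 0) (barlowPos a h s m ij.1 ij.2))) -
      c₂ * ∑' ij : ℤ × ℤ, (if ij = 0 then 0 else V₂ (dist (barlowPos a h s m 0 0) (barlowPos a h s m ij.1 ij.2))) := by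
    rw [← tsum_mul_left, ← tsum_mul_left, ← ((shp_summable_punctured (hF₁ m)).mul_left c₁).tsum_sub
      ((shp_summable_punctured (hF₂ m)).mul_left c₂)]
    refine tsum_congr fun ij => ?_
    split_ifs <;> ring
  have hY : ∑' n : ℕ, ∑' ij : ℤ × ℤ,
        (c₁ * V₁ (dist (barlowPos a h s m 0 0) (barlowPos a h s (m + (n + 1 : ℕ)) ij.1 ij.2)) -
          c₂ * V₂ (dist (barlowPos a h s m 0 0) (barlowPos a h s (m + (n + 1 : ℕ)) ij.1 ij.2))) =
      c₁ * ∑' n : ℕ, ∑' ij : ℤ × ℤ, V₁ (dist (barlowPos a h s m 0 0) (barlowPos a h s (m + (n + 1 : ℕ)) ij.1 ij.2)) -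
      c₂ * ∑' n : ℕ, ∑' ij : ℤ × ℤ, V₂ (dist (barlowPos a h s m 0 0) (barlowPos a h s (m + (n + 1 : ℕ)) ij.1 ij.2)) := by
    rw [← tsum_mul_left, ← tsum_mul_left, ← (hA₁.mul_left c₁).tsum_sub (hA₂.mul_left c₂)]
    refine tsum_congr fun n => ?_
    rw [← tsum_mul_left, ← tsum_mul_left, ← ((hF₁ _).mul_left c₁).tsum_sub ((hF₂ _).mul_left c₂)]
  have hZ : ∑' n : ℕ, ∑' ij : ℤ × ℤ,
        (c₁ * V₁ (dist (barlowPos a h s m 0 0) (barlowPos a h s (m - (n + 1 : ℕ)) ij.1 ij.2)) -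
          c₂ * V₂ (dist (barlowPos a h s m 0 0) (barlowPos a h s (m - (n + 1 : ℕ)) ij.1 ij.2))) =
      c₁ * ∑' n : ℕ, ∑' ij : ℤ × ℤ, V₁ (dist (barlowPos a h s m 0 0) (barlowPos a h s (m - (n + 1 : ℕ)) ij.1 ij.2)) -
      c₂ * ∑' n : ℕ, ∑' ij : ℤ × ℤ, V₂ (dist (barlowPos a h s m 0 0) (barlowPos a h s (m - (n + 1 : ℕ)) ij.1 ij.2)) := by
    rw [← tsum_mul_left, ← tsum_mul_left, ← (hB₁.mul_left c₁).tsum_sub (hB₂.mul_left c₂)]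
    refine tsum_congr fun n => ?_
    rw [← tsum_mul_left, ← tsum_mul_left, ← ((hF₁ _).mul_left c₁).tsum_sub ((hF₂ _).mul_left c₂)]
  simp only [barlowSiteEnergy]
  rw [hX, hY, hZ]
  ring

/-! ## Scaling -/

/-- **Scaling of the shape sums**: `barlowSiteEnergy Vₙ a (a c) s m = (a²)⁻ⁿ · barlowSiteEnergy Vₙ 1 c s m` for
`Vₙ r = (r²)⁻ⁿ` and `a > 0`. [folklore] -/
theorem shp_barlowSiteEnergy_smul (n : ℕ) {a : ℝ} (ha : 0 < a) (c : ℝ) (s : ℤ → ℤ) (m : ℤ) :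
    barlowSiteEnergy (fun r => (r ^ 2)⁻¹ ^ n) a (a * c) s m =
      (a ^ 2)⁻¹ ^ n * barlowSiteEnergy (fun r => (r ^ 2)⁻¹ ^ n) 1 c s m := by
  have key : ∀ r : ℝ, ((a * r) ^ 2)⁻¹ ^ n = (a ^ 2)⁻¹ ^ n * ((r ^ 2)⁻¹ ^ n) := by
    intro r; rw [mul_pow, mul_inv, mul_pow]
  have hite : ∀ (ij : ℤ × ℤ) (x : ℝ), (if ij = 0 then (0 : ℝ) else (a ^ 2)⁻¹ ^ n * x) =
      (a ^ 2)⁻¹ ^ n * (if ij = 0 then (0 : ℝ) else x) := by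
    intro ij x; split_ifs <;> simp
  simp only [barlowSiteEnergy, shp_dist_barlowPos_smul ha.le c s, key, hite, tsum_mul_left]
  ring

/-! ## The Lennard-Jones site energy -/

/-- `V_LJ = V₆/12 − V₃/6` with `Vₙ r = (r²)⁻ⁿ`. [folklore] -/
theorem shp_lennardJones_eq_shape :
    lennardJones = fun r : ℝ => (1 / 12) * ((r ^ 2)⁻¹ ^ 6) - (1 / 6) * ((r ^ 2)⁻¹ ^ 3) := by
  funext r
  unfold lennardJones
  rw [inv_pow, inv_pow, inv_pow, inv_pow, ← pow_mul, ← pow_mul]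

/-- The index family of `Vₙ r = (r²)⁻ⁿ` is the inverse-power family of exponent `2n`. [folklore] -/
theorem shp_shape_eq_inv_pow (n : ℕ) (r : ℝ) : (r ^ 2)⁻¹ ^ n = (r⁻¹) ^ (2 * n) := by
  rw [inv_pow, inv_pow, ← pow_mul]

/-- Summability of the index family of `Vₙ` for `n = 3, 6` (`a, h > 0`). [folklore] -/
theorem shp_summable_shape_index {a h : ℝ} (ha : 0 < a) (hh : 0 < h) (s : ℤ → ℤ) (t₀ : ℤ × ℤ × ℤ) (n : ℕ)
    (hn : 2 ≤ n) :
    Summable fun t : ℤ × ℤ × ℤ =>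
      ((dist (barlowPos a h s t₀.1 t₀.2.1 t₀.2.2) (barlowPos a h s t.1 t.2.1 t.2.2)) ^ 2)⁻¹ ^ n := by
  obtain ⟨k, rfl⟩ : ∃ k, n = k + 2 := ⟨n - 2, by omega⟩
  have h := shp_summable_inv_pow_index ha hh s t₀ (k := 2 * k + 1) (by omega)
  refine h.congr fun t => ?_
  rw [shp_shape_eq_inv_pow, show 2 * (k + 2) = 2 * k + 1 + 3 by ring]

/-- **The Lennard-Jones site energy of a rotated Barlow stacking, in shape sums.** For `a, c > 0`, a linear isometry
`A`, any label sequence `s`, and any point `p = A (barlowPos a (a c) s m i₀ j₀)` of layer `m`: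
`∑'_{q ∈ A(stacking), q ≠ p} V_LJ |p − q| = 2 ((1/12) (a²)⁻⁶ σ₆(m) − (1/6) (a²)⁻³ σ₃(m))`,
`σₙ(m) = barlowSiteEnergy Vₙ 1 c s m`. [folklore] -/
theorem shp_site_lennardJones {a c : ℝ} (ha : 0 < a) (hc : 0 < c) (s : ℤ → ℤ)
    (A : EuclideanSpace ℝ (Fin 3) →ₗᵢ[ℝ] EuclideanSpace ℝ (Fin 3)) (m i₀ j₀ : ℤ) :
    ∑' q : {q : EuclideanSpace ℝ (Fin 3) // q ∈ A '' barlowStacking a (a * c) s ∧ q ≠ A (barlowPos a (a * c) s m i₀ j₀)},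
        lennardJones (dist (A (barlowPos a (a * c) s m i₀ j₀)) (q : EuclideanSpace ℝ (Fin 3))) =
      2 * ((1 / 12) * ((a ^ 2)⁻¹ ^ 6 * barlowSiteEnergy (fun r => (r ^ 2)⁻¹ ^ 6) 1 c s m) -
        (1 / 6) * ((a ^ 2)⁻¹ ^ 3 * barlowSiteEnergy (fun r => (r ^ 2)⁻¹ ^ 3) 1 c s m)) := by
  have hh : 0 < a * c := mul_pos ha hc
  have hLJ := shp_summable_lennardJones_index ha hh s (m, 0, 0)
  have h6 := shp_summable_shape_index ha hh s (m, 0, 0) 6 (by norm_num)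
  have h3 := shp_summable_shape_index ha hh s (m, 0, 0) 3 (by norm_num)
  rw [shp_site_tsum_eq ha hh s A lennardJones lennardJones_zero m i₀ j₀ hLJ, shp_lennardJones_eq_shape,
    shp_barlowSiteEnergy_linear s m (fun r => (r ^ 2)⁻¹ ^ 6) (fun r => (r ^ 2)⁻¹ ^ 3) (1 / 12) (1 / 6) h6 h3,
    shp_barlowSiteEnergy_smul 6 ha c s m, shp_barlowSiteEnergy_smul 3 ha c s m]

end Summit.AtomisticToContinuum.Crystallization.Theorems.PeriodicWindowsSketch

end
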